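import Summits.BirchSwinnertonDyer.BirchSwinnertonDyer.Theorems.EisensteinPrimesAcTwistDeformationCurveStrictAtShapiro
import Summits.BirchSwinnertonDyer.BirchSwinnertonDyer.Theorems.EisensteinPrimesAcTwistDeformationCurveSurAtVbar
import Summits.BirchSwinnertonDyer.BirchSwinnertonDyer.Theorems.EisensteinPrimesResidualDevissageNonsplitLambdaIdentityAtNonsplit
import HarnessLib

/-!
# (N1)^{Sf}: Castella's `Sf`-imprimitive dual `𝔛^{Sf}_f = XAc E_K p κ v̄ ↑Sf γ` HAS NO `p`-TORSION, modulo Greenberg's published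
# facts by name; hence Keller–Yin Thm. 1.4.1's λ-identity `λ(𝔛^{Sf}_f) = λ(𝔛^{Sf}_{θsub}) + λ(𝔛^{Sf}_{θquot})` WITH EQUALITY at every
# NON-SPLIT multiplicative Eisenstein datum, modulo PUBLISHED facts by name
# (cell `bsd-eis`, width seat `bsd-line-x2-p2` gen 7; crux 4 `BSDpOnCellC` stmt-BirchSwinnertonDyer-19034, line b1 v12; assembly of
# p651263 `…CurveAlmostDivisible`, p652003 `…ShapiroOnto`, `…CurveStrictAtShapiro`, with g6's p649247)

HONEST FRAMING (cell `bsd-eis`, run/shared/lean/pub/bsd-eis/): bookkeeping on constructed objects; no definition, no named fact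
INTRODUCED, no `sorry`, no `Theses` import; nothing about BSD or a main conjecture is asserted; nothing booked; no label or count
moves. Helper `--supports stmt-BirchSwinnertonDyer-19034`; closes no stub of b1 v12 by itself. CONDITIONAL, BY NAME, on:
Greenberg 2016 Prop. 4.1.1 (`prop411_selmer_isAlmostDivisible`) and Greenberg 2006 Props. 4.1, 4.2, 3.2 (`prop41_…`, `prop42_…`,
`prop32_…`) [PUB]; for §2–§3 also on CGLS22 Prop. 14's finiteness clause (`prop14_residualCharacterSelmer_finite`) [PUB], the
hypothesis of g4's p626493; for §3 also on CGLS22 Prop. 1.2.5 + Cor. 1.2.6 (`prop125_characterGrSelmerDual_torsion_muZero_dim`,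
`cor126_residualCharacter_globalLift`, `cor126_residualCharacter_localSurjective`) [PUB], the hypotheses of g6's p649247.

## What

* §1 **`xAc_smul_eq_zero_imp_of_facts`** — for `E = W/ℚ` over the imaginary quadratic `K` ((Heeg) for `N_E`), `2 < p = v v̄`, `κ`
  anticyclotomic with topological generator `γ`, `Sf` = the places of `K` over `N_E` NOT over `p` (g6's `hSf`): if `𝔛^{Sf}_f` is
  finitely generated, `Λ`-torsion, `μ = 0`, then **`∀ x : 𝔛^{Sf}_f, p • x = 0 → x = 0`** (no `p`-torsion = no non-zero finite
  `Λ`-submodule), GRANTED the four Greenberg facts by name. Chain: model `ρ₀` of `E_K[p^∞]` over `G_{K,S}`, `S = {v, v̄} ∪ Sf`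
  (Néron–Ogg–Shafarevich), discrete instances, `σ`-supply on `S` (Brink / class field theory), `corank_Λ S_{𝓛^{v̄}}(K, 𝐃_E) = 0`
  (`hasCorank_strictAtSelmer_zero_of_xAc`), Greenberg 2016 Prop. 4.1.1 (c) (`primaryTorsion_strictAtSelmer_isAlmostDivisible`), Shapiro
  + duality (`xAc_eq_zero_of_smul_eq_zero_of_isAlmostDivisible`). Reduction-type-free (good, multiplicative or additive `p`).
* §2 `xAc_moduleFinite_isTorsion_muInvariant_of_prop14_of_not_split` — `𝔛^{Sf}_f` finitely generated (Castella, unconditional: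
  `XAc.module_finite`), `Λ`-torsion with `μ = 0` at a NON-SPLIT multiplicative Eisenstein datum (g4's
  `KellerYinLemma511NonsplitOfPrint.isTorsion_muInvariant_eq_zero_of_prop14_of_not_split`, from CGLS22 Prop. 14 by name).
* §3 **`lambdaInvariant_xAc_eq_add_of_not_split_of_facts`** — at every NON-SPLIT multiplicative Eisenstein datum of Keller–Yin Lemma
  5.1.1 and EVERY residual pair `(θsub, θquot)` of `E_K[p]`: **`λ(𝔛^{Sf}_f) = λ(Dsub.X) + λ(Dquot.X)`** for all strict dual data —
  g6's `lambdaInvariant_le_add_of_isResidualPairOver_of_not_split` (p649247) with its ONE remaining E-level input DISCHARGED by §1–§2.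
  This is the algebraic third [ALG-imp] of the wall `stub_imprimitiveCount` on the GV/CGLS road IN THE KERNEL MODULO PUBLISHED facts
  (CGLS22 §1.2 ×4, Greenberg 2016/2006 ×4) — no preprint input, no (N1) hypothesis, no character-cotorsion hypothesis left.

References: [Greenberg2016Selmer] Prop. 4.1.1 (c); [Greenberg2006] Thm. 3, Props. 3.2, 4.1, 4.2, §5 A; [CastellaGrossiLeeSkinner2022]
§1.2 Prop. 1.2.5, Cor. 1.2.6, §1.4 Props. 1.4.1–1.4.2, Cor. 1.4.3; [KellerYin2024] Thm. 1.4.1, §1.4 (e), Lemma 5.1.1, §5.1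
(arXiv:2402.12781v2); [PollackWeston2011] App. A Prop. A.2; [Castella2018] Def. 2.2.
-/

set_option autoImplicit false
set_option linter.dupNamespace false -- the summit namespace `…BirchSwinnertonDyer.BirchSwinnertonDyer.Theorems` (Sub = Summit, D-0017) trips it

noncomputable section

open scoped Classical
open NumberField IsDedekindDomain Field Multiplicative PowerSeries WeierstrassCurve
open Literature.NumberTheory.EllipticCurves Literature.NumberTheory.EllipticCurves.GreenbergSelmer
  Literature.NumberTheory.EllipticCurves.GreenbergVatsal2000 Literature.NumberTheory.GaloisRepresentations
  Literature.NumberTheory.EllipticCurves.KellerYin2024 Literature.NumberTheory.EllipticCurves.IwasawaDual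
  Literature.NumberTheory.EllipticCurves.Castella2018.AcSelmer Literature.NumberTheory.EllipticCurves.Rank1Residual
  Literature.NumberTheory.EllipticCurves.CastellaGrossiLeeSkinner2022
  Literature.NumberTheory.IwasawaTheory Literature.NumberTheory.IwasawaTheory.Greenberg2016
  Literature.NumberTheory.IwasawaTheory.Greenberg2006
  Summit.BirchSwinnertonDyer.BirchSwinnertonDyer.Theorems.GreenbergFullAtSelmer
  Summit.BirchSwinnertonDyer.BirchSwinnertonDyer.Theorems.AcTwistDeformationResidualPair
  Summit.BirchSwinnertonDyer.BirchSwinnertonDyer.Theorems.AcTwistDeformation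

namespace Summit.BirchSwinnertonDyer.BirchSwinnertonDyer.Theorems.XAcImprimitiveNoPTorsion

variable {K : Type} [Field K] [NumberField K] {p : ℕ} [Fact p.Prime]

/-! ## §1 No `p`-torsion in `𝔛^{Sf}_f`, modulo Greenberg's facts by name -/

/-- **(N1)^{Sf} — `𝔛^{Sf}_f = XAc E_K p κ v̄ ↑Sf γ` HAS NO `p`-TORSION**, for `E = W/ℚ` over the imaginary quadratic `K` with the
Heegner hypothesis for `N_E`, `2 < p = v v̄` split, `κ` anticyclotomic with topological generator `γ`, `Sf` the places of `K` over
`N_E` not over `p`, and `𝔛^{Sf}_f` finitely generated, `Λ`-torsion with `μ = 0`; GRANTED Greenberg 2016 Prop. 4.1.1 and Greenberg 2006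
Props. 4.1, 4.2, 3.2 BY NAME. Equivalently: `𝔛^{Sf}_f` has no non-zero finite `Λ`-submodule (CGLS22 Cor. 1.4.3, Keller–Yin §1.4 (e),
Pollack–Weston Prop. A.2 — there for good `p`; here ANY reduction type at `p`).
[cite: Greenberg2016Selmer, Prop. 4.1.1 (c) (§4.1 p. 15 L21–32), §4.3 pp. 20–21] [cite: Greenberg2006, Thm. 3, Props. 3.2, 4.1, 4.2, §5 A]
[cite: CastellaGrossiLeeSkinner2022, Cor. 1.4.3] [cite: KellerYin2024, §1.4 (e) (arXiv:2402.12781v2 TeX L1162–1181)]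
[cite: PollackWeston2011, App. A Prop. A.2] -/
theorem xAc_smul_eq_zero_imp_of_facts (h411 : prop411_selmer_isAlmostDivisible)
    (h41 : prop41_globalEulerPoincareCorank) (h42 : prop42_localEulerPoincareCorank)
    (h32 : prop32_cohomology_isCofinitelyGenerated)
    (W : WeierstrassCurve ℚ) [W.IsElliptic] (hp : 2 < p) (hK : IsImaginaryQuadratic K)
    (hH : SatisfiesHeegnerHypothesis (W.conductorNorm ℤ) K)
    {v vbar : HeightOneSpectrum (𝓞 K)} (hv : ((p : ℕ) : 𝓞 K) ∈ v.asIdeal)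
    (hvbar : ((p : ℕ) : 𝓞 K) ∈ vbar.asIdeal) (hne : vbar ≠ v)
    (κ : ZpExtension K p) (hκ : κ.IsAnticyclotomic) (γ : absoluteGaloisGroup K) [Fact (κ.IsTopGenerator γ)]
    (Sf : Finset (HeightOneSpectrum (𝓞 K)))
    (hSf : ∀ w : HeightOneSpectrum (𝓞 K), w ∈ Sf ↔
      (((W.conductorNorm ℤ : ℤ) : 𝓞 K) ∈ w.asIdeal ∧ ((p : ℕ) : 𝓞 K) ∉ w.asIdeal))
    (hXfin : Module.Finite (IwasawaAlgebra p) (XAc (W.baseChange K) p κ vbar (↑Sf : Set (HeightOneSpectrum (𝓞 K))) γ))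
    (hXtor : Module.IsTorsion (IwasawaAlgebra p) (XAc (W.baseChange K) p κ vbar (↑Sf : Set (HeightOneSpectrum (𝓞 K))) γ))
    (hμ : muInvariant p (XAc (W.baseChange K) p κ vbar (↑Sf : Set (HeightOneSpectrum (𝓞 K))) γ) = 0)
    (x : XAc (W.baseChange K) p κ vbar (↑Sf : Set (HeightOneSpectrum (𝓞 K))) γ) (hx : p • x = 0) : x = 0 := by
  haveI hEK : (W.baseChange K).IsElliptic := inferInstanceAs (W.map (algebraMap ℚ K)).IsElliptic
  -- `S = {v, v̄} ∪ Sf` contains the places above `p` and the bad places of `E_K`; `S ∩ {w ∤ p} = Sf`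
  set S : Set (HeightOneSpectrum (𝓞 K)) := (↑(insert v (insert vbar Sf)) : Set (HeightOneSpectrum (𝓞 K))) with hSdef
  have hS : ∀ w : HeightOneSpectrum (𝓞 K), ((p : ℕ) : 𝓞 K) ∈ w.asIdeal → w ∈ S :=
    mem_insert_insert_of_natCast_mem hK hv hvbar hne Sf
  have hSfS : ∀ w ∈ Sf, w ∈ S := fun w hw ↦ by
    rw [hSdef, Finset.coe_insert, Finset.coe_insert]
    exact Or.inr (Or.inr (Finset.mem_coe.mpr hw))
  have hSf₁ : (↑Sf : Set (HeightOneSpectrum (𝓞 K))) ⊆ S := fun w hw ↦ hSfS w (Finset.mem_coe.mp hw)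
  have hSf₂ : ∀ w ∈ S, ((p : ℕ) : 𝓞 K) ∉ w.asIdeal → w ∈ (↑Sf : Set (HeightOneSpectrum (𝓞 K))) := by
    intro w hw hpw
    rw [hSdef, Finset.coe_insert, Finset.coe_insert] at hw
    rcases hw with rfl | rfl | hw
    · exact absurd hv hpw
    · exact absurd hvbar hpw
    · exact hw
  have hgoodN : ∀ w : HeightOneSpectrum (𝓞 K), ((W.conductorNorm ℤ : ℤ) : 𝓞 K) ∉ w.asIdeal →
      (W.baseChange K).HasGoodReductionAt w := fun w hw ↦
    EisensteinPrimesMuLambda.hasGoodReductionAt_baseChange_of_conductorNorm_notMem W w hw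
  have hSbad : ∀ w : HeightOneSpectrum (𝓞 K), ¬ (W.baseChange K).HasGoodReductionAt w → w ∈ S := by
    intro w hw
    have hN : ((W.conductorNorm ℤ : ℤ) : 𝓞 K) ∈ w.asIdeal := by_contra fun h ↦ hw (hgoodN w h)
    by_cases hpw : ((p : ℕ) : 𝓞 K) ∈ w.asIdeal
    · exact hS w hpw
    · exact hSfS w ((hSf w).mpr ⟨hN, hpw⟩)
  have hgood : ∀ w : HeightOneSpectrum (𝓞 K), w ∉ S → ((p : ℕ) : 𝓞 K) ∉ w.asIdeal →
      (W.baseChange K).HasGoodReductionAt w := fun w hw _ ↦ by_contra fun h ↦ hw (hSbad w h)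
  -- the model `ρ₀` of `E_K[p^∞]` over `G_{K,S}` (Néron–Ogg–Shafarevich)
  have hNS : ∀ n ∈ ramificationSubgroup K S, ∀ P : PrimaryTorsion (W.baseChange K).geomPoints p, n • P = P :=
    fun n hn P ↦ SignedBaseChangeAcDivCurveModel.smul_primaryTorsion_eq_of_mem_ramificationSubgroup
      (W.baseChange K) p S hSbad hS hn P
  obtain ⟨ρ₀, hρ₀⟩ := SignedBaseChangeAcDivCurveModel.exists_continuousRep_primaryTorsion (W.baseChange K) p S hNS
  -- the canonical (discrete) topological instances of the arena
  letI tΛ : TopologicalSpace (PowerSeries ℤ_[p]) := ⊥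
  haveI : DiscreteTopology (PowerSeries ℤ_[p]) := ⟨rfl⟩
  haveI : IsTopologicalRing (PowerSeries ℤ_[p]) := inferInstance
  haveI : IsTopologicalAddGroup (BigRepModule ℤ_[p] p (PrimaryTorsion (W.baseChange K).geomPoints p)) :=
    inferInstance
  haveI : ContinuousSMul (PowerSeries ℤ_[p]) (BigRepModule ℤ_[p] p (PrimaryTorsion (W.baseChange K).geomPoints p)) :=
    inferInstance
  -- `K` imaginary quadratic; the `σ`-supply on `S` (class field theory above `p`, Brink + (Heeg) at `Sf`)
  haveI := hK.2
  have hKc : ∀ w : InfinitePlace K, w.IsComplex := IsTotallyComplex.isComplex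
  have hsup : ∀ w : HeightOneSpectrum (𝓞 K), w ∈ S →
      ∃ σ : absoluteGaloisGroup (Place.Completion (Sum.inr w : Place K)), κ (absGaloisRestrict K _ σ) ≠ 1 := by
    intro w hw
    refine exists_local_apply_ne_one_of_mem_or hK hp hH κ hκ w ?_
    rw [hSdef, Finset.coe_insert, Finset.coe_insert] at hw
    rcases hw with rfl | rfl | hw
    · exact Or.inl hv
    · exact Or.inl hvbar
    · exact Or.inr ((hSf w).mp (Finset.mem_coe.mp hw)).1
  -- the Shapiro descent with `ψ = id`
  let ψ : PrimaryTorsion (W.baseChange K).geomPoints p ≃+ (W.baseChange K).geomPrimaryTorsion p := AddEquiv.refl _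
  have hψ : ∀ (σ : absoluteGaloisGroup K) (a : PrimaryTorsion (W.baseChange K).geomPoints p),
      ψ (ρ₀ (toUnramifiedQuot K S σ) a) = σ • ψ a := fun σ a ↦ by rw [hρ₀]; rfl
  obtain ⟨F, hF⟩ := exists_shapiroDescent S hS κ ρ₀ ψ hψ
  -- the specification `𝓛^{v̄}` ("`0` at `v̄`, `⊤` elsewhere"), as a term (no definition)
  let L : Specification S (bigRep (κ.liftUnramifiedOutside S hS) ρ₀) := fun w ↦ if w = Sum.inr vbar then ⊥ else ⊤
  have hL : ∀ w : Place K, L w = if w = Sum.inr vbar then ⊥ else ⊤ := fun w ↦ rfl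
  -- corank `0`, Prop. 4.1.1 (c), Shapiro + duality
  have hSel := hasCorank_strictAtSelmer_zero_of_xAc S (W.baseChange K) hS κ ρ₀ hρ₀ hKc hvbar
    (↑Sf : Set (HeightOneSpectrum (𝓞 K))) hSf₁ hSf₂ hgood hF L hL hXfin hXtor
  have hAD := primaryTorsion_strictAtSelmer_isAlmostDivisible (W.baseChange K) hS κ ρ₀ h411 h41 h42 h32
    (Finset.finite_toSet _) hK hsup hne hv hvbar L hL hSel
  exact xAc_eq_zero_of_smul_eq_zero_of_isAlmostDivisible S (W.baseChange K) hS κ ρ₀ hρ₀ hKc hvbar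
    (↑Sf : Set (HeightOneSpectrum (𝓞 K))) hSf₁ hSf₂ hgood hF L hL hAD hXfin hXtor hμ x hx

/-! ## §2 `𝔛^{Sf}_f` is finitely generated `Λ`-torsion with `μ = 0` at a NON-SPLIT multiplicative Eisenstein prime (g4, from CGLS Prop. 14) -/

/-- **`𝔛^{Sf}_f` finitely generated, `Λ`-torsion, `μ = 0` at a non-split multiplicative Eisenstein datum**, from the PUBLISHED CGLS22
Prop. 14 finiteness clause BY NAME (g4's `KellerYinLemma511NonsplitOfPrint.isTorsion_muInvariant_eq_zero_of_prop14_of_not_split`,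
p626493) and Castella's unconditional finite generation (`XAc.module_finite`). [cite: CastellaGrossiLeeSkinner2022, §1.2 Prop. 14, §1.4 Props. 17–18 (arXiv:2008.02571)]
[cite: KellerYin2024, Lemma 5.1.1 (arXiv:2402.12781v2 §5.1 TeX L1744–1749)] [cite: Castella2018, §2.1 Def. 2.2 (arXiv:1704.06608 p. 5)] -/
theorem xAc_moduleFinite_isTorsion_muInvariant_of_prop14_of_not_split (hfact : prop14_residualCharacterSelmer_finite)
    (W : WeierstrassCurve ℚ) [W.IsElliptic] [W.IsGloballyMinimal]
    (K : Type) [Field K] [NumberField K] (vbar : HeightOneSpectrum (𝓞 K))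
    (κ : ZpExtension K p) (γ : absoluteGaloisGroup K) [Fact (κ.IsTopGenerator γ)]
    (Sf : Finset (HeightOneSpectrum (𝓞 K)))
    (hp2 : 2 < p) (hmult : Mult W p) (hns : ¬ W.HasSplitMultiplicativeReductionAtPrime p) (hred : Red W p)
    (hK : IsImaginaryQuadratic K) (hH : SatisfiesHeegnerHypothesis (W.conductorNorm ℤ) K)
    (hsplit : ((Ideal.span {(p : ℤ)}).primesOver (𝓞 K)).ncard = 2)
    (hvbar : ((p : ℕ) : 𝓞 K) ∈ vbar.asIdeal) (hκ : κ.IsAnticyclotomic)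
    (hSf : ∀ w : HeightOneSpectrum (𝓞 K), w ∈ Sf ↔
      (((W.conductorNorm ℤ : ℤ) : 𝓞 K) ∈ w.asIdeal ∧ ((p : ℕ) : 𝓞 K) ∉ w.asIdeal)) :
    Module.Finite (IwasawaAlgebra p) (XAc (W.baseChange K) p κ vbar (↑Sf : Set (HeightOneSpectrum (𝓞 K))) γ) ∧
      Module.IsTorsion (IwasawaAlgebra p) (XAc (W.baseChange K) p κ vbar (↑Sf : Set (HeightOneSpectrum (𝓞 K))) γ) ∧
      muInvariant p (XAc (W.baseChange K) p κ vbar (↑Sf : Set (HeightOneSpectrum (𝓞 K))) γ) = 0 := by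
  haveI hEK : (W.baseChange K).IsElliptic := inferInstanceAs (W.map (algebraMap ℚ K)).IsElliptic
  exact ⟨XAc.module_finite (W.baseChange K) p κ vbar _ γ (Finset.finite_toSet Sf),
    KellerYinLemma511NonsplitOfPrint.isTorsion_muInvariant_eq_zero_of_prop14_of_not_split hfact W K vbar κ γ Sf hp2 hmult hns
      hred hK hH hsplit hvbar hκ hSf⟩

/-! ## §3 Keller–Yin Thm. 1.4.1's λ-identity WITH EQUALITY at a non-split multiplicative Eisenstein datum, modulo PUB -/

/-- **`λ(𝔛^{Sf}_f) = λ(𝔛^{Sf}_{θsub}) + λ(𝔛^{Sf}_{θquot})` at every NON-SPLIT multiplicative Eisenstein datum and EVERY residual pair,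
MODULO PUBLISHED FACTS BY NAME** — g6's `lambdaInvariant_le_add_of_isResidualPairOver_of_not_split` (p649247: `≤`, and `=` granted
«`𝔛^{Sf}_f` has no `p`-torsion») with that input DISCHARGED by §1 (Greenberg 2016 Prop. 4.1.1 + Greenberg 2006 Props. 4.1/4.2/3.2 by
name) and §2 (f.g. / torsion / `μ = 0` from CGLS22 Prop. 14 by name, g4). Binders: `W/ℚ` globally minimal, `2 < p = v v̄`, `p ‖ N`
NON-split, `E[p]` reducible (`Red`), `K` imaginary quadratic with (Heeg) for `N_E`, `κ` anticyclotomic with generator `γ`, `Sf` = places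
over `N_E` off `p`, a residual pair `(θsub, θquot)` (`IsResidualPairOver`), ANY strict dual data `Dsub`, `Dquot` (`KellerYin2024.GrDualData`)
— CGLS's `𝔛^S_φ`, `𝔛^S_ψ`. Keller–Yin Thm. 1.4.1's λ-clause at `p ‖ N` non-split IN THE KERNEL modulo CGLS22 Props. 1.2.5 / 14 + Cor. 1.2.6
and Greenberg 2016 Prop. 4.1.1 + Greenberg 2006 Props. 3.2 / 4.1 / 4.2 — all PUBLISHED; no preprint input and no (N1) hypothesis left.
This is the algebraic third [ALG-imp] of line b1's wall `stub_imprimitiveCount` on the GV/CGLS road.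
[cite: KellerYin2024, Thm. 1.4.1, Lemma 5.1.1 and §5.1 (arXiv:2402.12781v2 TeX L1087–1098, L1744–1778)]
[cite: CastellaGrossiLeeSkinner2022, §1.2 Prop. 1.2.5, Prop. 14, Cor. 1.2.6, §1.4 Props. 1.4.1–1.4.2, Cor. 1.4.3 (e-print TeX L681–905)]
[cite: Greenberg2016Selmer, Prop. 4.1.1 (c)] [cite: Greenberg2006, Props. 3.2, 4.1, 4.2] -/
theorem lambdaInvariant_xAc_eq_add_of_not_split_of_facts
    (hprop125 : prop125_characterGrSelmerDual_torsion_muZero_dim) (hfact : prop14_residualCharacterSelmer_finite)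
    (hlift : cor126_residualCharacter_globalLift) (hlocal : cor126_residualCharacter_localSurjective)
    (h411 : prop411_selmer_isAlmostDivisible) (h41 : prop41_globalEulerPoincareCorank)
    (h42 : prop42_localEulerPoincareCorank) (h32 : prop32_cohomology_isCofinitelyGenerated)
    (W : WeierstrassCurve ℚ) [W.IsElliptic] [W.IsGloballyMinimal]
    (K : Type) [Field K] [NumberField K] {v : HeightOneSpectrum (𝓞 K)} (vbar : HeightOneSpectrum (𝓞 K))
    (κ : ZpExtension K p) (γ : absoluteGaloisGroup K) [Fact (κ.IsTopGenerator γ)]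
    (Sf : Finset (HeightOneSpectrum (𝓞 K)))
    (hp2 : 2 < p) (hmult : Mult W p) (hns : ¬ W.HasSplitMultiplicativeReductionAtPrime p) (hred : Red W p)
    (hK : IsImaginaryQuadratic K) (hH : SatisfiesHeegnerHypothesis (W.conductorNorm ℤ) K)
    (hsplit : ((Ideal.span {(p : ℤ)}).primesOver (𝓞 K)).ncard = 2)
    (hv : ((p : ℕ) : 𝓞 K) ∈ v.asIdeal) (hvbar : ((p : ℕ) : 𝓞 K) ∈ vbar.asIdeal) (hne : vbar ≠ v) (hκ : κ.IsAnticyclotomic)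
    (hSf : ∀ w : HeightOneSpectrum (𝓞 K), w ∈ Sf ↔
      (((W.conductorNorm ℤ : ℤ) : 𝓞 K) ∈ w.asIdeal ∧ ((p : ℕ) : 𝓞 K) ∉ w.asIdeal))
    (θsub θquot : FramedGaloisRep K (padicCoeffIntegers (∅ : Set (PadicAlgCl p))) 1)
    (hpair : IsResidualPairOver (W.baseChange K) p θsub θquot)
    (Dsub : GrDualData κ (charModule (∅ : Set (PadicAlgCl p)) θsub) vbar (↑Sf : Set (HeightOneSpectrum (𝓞 K))) γ)
    (Dquot : GrDualData κ (charModule (∅ : Set (PadicAlgCl p)) θquot) vbar (↑Sf : Set (HeightOneSpectrum (𝓞 K))) γ) :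
    lambdaInvariant p (XAc (W.baseChange K) p κ vbar (↑Sf : Set (HeightOneSpectrum (𝓞 K))) γ) =
      lambdaInvariant p Dsub.X + lambdaInvariant p Dquot.X := by
  obtain ⟨hXfin, hXtor, hμ⟩ := xAc_moduleFinite_isTorsion_muInvariant_of_prop14_of_not_split hfact W K vbar κ γ Sf hp2 hmult hns
    hred hK hH hsplit hvbar hκ hSf
  exact (ResidualDevissageNonsplitLambdaIdentityAtNonsplit.lambdaInvariant_le_add_of_isResidualPairOver_of_not_split hprop125
    hlift hlocal W K vbar κ γ Sf hp2 hmult hns hK hH hsplit hvbar hκ hSf θsub θquot hpair Dsub Dquot).2.2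
    (fun x hx ↦ xAc_smul_eq_zero_imp_of_facts h411 h41 h42 h32 W hp2 hK hH hv hvbar hne κ hκ γ Sf hSf hXfin hXtor hμ x hx)

end Summit.BirchSwinnertonDyer.BirchSwinnertonDyer.Theorems.XAcImprimitiveNoPTorsion

end
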